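import Literature.NumberTheory.Transcendental.KZCubeRationalMoves

/-!
# `ReductionRigidity` (stmt-KontsevichZagierPeriods-3407), line `Sketch` (Padé box island, `w = 2`):
# stub `stub_boxPolynomial`

A POLYNOMIAL INTEGRAND ON THE CLOSED SQUARE IS A RATIONAL CONSTANT MODULO MOVES. For every
`P ∈ ℚ[x, y]` and every representation `r = [□², P]` (`□ = [0, 1]`, domain `KZ.cube 2`, integrand
agreeing with `P` on the square) there is a rational `γ` (namely `γ = ∫_{□²} P`) and a representation
`s₀ = [pt, γ]` in dimension `0` with `[r] − [s₀] ∈ KZ.relations`.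

The proof is inside Kontsevich–Zagier's calculus of moves, over the tree's regular-rational-function
API `KZ.RFun` (`KZCubeRational.lean`, `KZCubeRationalMoves.lean`):

* `boxPolynomial_rel_powMulLift` — ONE Newton–Leibniz move (rule (3), Ayoub's Stokes relation
  `RFun.stokes`) with the polynomial primitive `x_last^{b+1}/(b+1) · T∘init`:
  `[□^{M+1}, x_last^b · T∘init] ≡ [□^M, T/(b+1)]` (the case `b = 0` is `RFun.rel_lift`);
* `boxPolynomial_monomial` — twice that move: `[□², c x^a y^b] ≡ [□¹, c x^a/(b+1)] ≡
  [pt, c/((a+1)(b+1))]`;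
* `boxPolynomial_exists_const` — monomial by monomial (`MvPolynomial.induction_on'`), the pieces
  merged by rule (1) (`boxPolynomial_rel_add3`);
* `stub_boxPolynomial` — the registered signature: the arbitrary `r` is first replaced by the cube
  representation of `RFun.poly P` (`KZ.of_sub_of_mem_relations_of_eqOn`), and `s₀` is the cube
  representation of `RFun.const γ`.

## References

* M. Kontsevich, D. Zagier, *Periods* (2001), §1.1–1.2. [cite: KontsevichZagier2001, §1.2]
* J. Ayoub, *Periods and the conjectures of Grothendieck and Kontsevich–Zagier*, EMS Newsletter 91
  (2014), §2.2, Def. 10. [cite: Ayoub2014, Def. 10]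
-/

noncomputable section

open MeasureTheory Set MvPolynomial

namespace Summit.KontsevichZagierPeriods.HermiteRigidity.ReductionRigidity

open Literature.NumberTheory.Transcendental
open Literature.NumberTheory.Transcendental.KZ

/-! ## Bookkeeping in the group of formal representations -/

/-- Transitivity of congruence modulo `KZ.relations`. [folklore] -/
theorem boxPolynomial_rel_trans {x y z : FormalRep} (h₁ : x - y ∈ KZ.relations)
    (h₂ : y - z ∈ KZ.relations) : x - z ∈ KZ.relations := by
  have h := KZ.relations.add_mem h₁ h₂
  rwa [sub_add_sub_cancel] at h

/-- Rule (1) for three regular rational functions on the same cube: `U = T + S` on `[0,1]^M` gives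
`[U] − [T] − [S] ∈ relations`. [cite: KontsevichZagier2001, §1.2 rule (1)] -/
theorem boxPolynomial_rel_add3 {M : ℕ} (U T S : RFun M)
    (h : ∀ x ∈ KZ.cube M, U.fn x = T.fn x + S.fn x) :
    KZ.of U.rep - KZ.of T.rep - KZ.of S.rep ∈ KZ.relations :=
  integrandAddRel_subset_relations ⟨M, U.rep, T.rep, S.rep, rfl, rfl, fun x hx => h x hx, rfl⟩

/-! ## One Newton–Leibniz move: integrating out a power of the last variable -/

/-- **Integrating out a power of the last variable**: `[□^{M+1}, x_last^b · T∘init] ≡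
[□^M, T/(b+1)]` — one Newton–Leibniz move with the polynomial primitive
`x_last^{b+1}/(b+1) · T∘init`, whose face at `x_last = 1` is `T/(b+1)` and whose face at
`x_last = 0` vanishes (the case `b = 0` is `RFun.rel_lift`).
[cite: KontsevichZagier2001, §1.2 rule (3)] -/
theorem boxPolynomial_rel_powMulLift {M : ℕ} (T : RFun M) (b : ℕ) :
    KZ.of ((RFun.poly (X (Fin.last M) ^ b)).mul T.lift).rep -
      KZ.of ((RFun.const (1 / ((b : ℚ) + 1))).mul T).rep ∈ KZ.relations := by
  -- adapted from `RFun.rel_lift` (Literature/NumberTheory/Transcendental/KZCubeRationalMoves.lean)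
  set G : RFun (M + 1) := (RFun.poly (X (Fin.last M) ^ b)).mul T.lift with hG
  set F : RFun (M + 1) :=
    (RFun.poly (C (1 / ((b : ℚ) + 1)) * X (Fin.last M) ^ (b + 1))).mul T.lift with hF
  have hb : ((b : ℝ) + 1) ≠ 0 := by positivity
  have hst := RFun.stokes F
  have e1 : KZ.of F.dlast.rep - KZ.of G.rep ∈ KZ.relations := by
    refine RFun.rel_of_eqOn fun y hy => ?_
    -- compare the two derivatives of `s ↦ F (init y, s)` at `s = y last`
    have hy' : Fin.init y ∈ KZ.cube M := fun i => hy (Fin.castSucc i)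
    have hlast : y (Fin.last M) ∈ Icc (0 : ℝ) 1 := ⟨(hy _).1, (hy _).2⟩
    have hd := F.hasDerivAt_fn_snoc hy' hlast
    rw [Fin.snoc_init_self] at hd
    have hd' : HasDerivAt (fun s : ℝ => F.fn (Fin.snoc (Fin.init y) s)) (G.fn y)
        (y (Fin.last M)) := by
      have hfun : (fun s : ℝ => F.fn (Fin.snoc (Fin.init y) s)) =
          fun s => ((1 / ((b : ℚ) + 1) : ℚ) : ℝ) * s ^ (b + 1) * T.fn (Fin.init y) := by
        funext s
        rw [hF, RFun.fn_mul, RFun.fn_poly, RFun.fn_lift_snoc]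
        simp only [map_mul, map_pow, aeval_C, aeval_X, Fin.snoc_last, eq_ratCast]
      have hGy : G.fn y = y (Fin.last M) ^ b * T.fn (Fin.init y) := by
        rw [hG, RFun.fn_mul, RFun.fn_poly, RFun.fn_lift, map_pow, aeval_X]
      rw [hfun, hGy]
      have h1 := ((hasDerivAt_pow (b + 1) (y (Fin.last M))).const_mul
        ((1 / ((b : ℚ) + 1) : ℚ) : ℝ)).mul_const (T.fn (Fin.init y))
      refine h1.congr_deriv ?_
      rw [Nat.add_sub_cancel]
      push_cast
      rw [one_div, inv_mul_cancel_left₀ hb]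
    exact hd.unique hd'
  have e2 : KZ.of (F.face 1 ⟨zero_le_one, le_rfl⟩).rep -
      KZ.of ((RFun.const (1 / ((b : ℚ) + 1))).mul T).rep ∈ KZ.relations :=
    RFun.rel_of_eqOn fun x _ => by
      rw [RFun.fn_face, hF]
      simp only [RFun.fn_mul, RFun.fn_poly, RFun.fn_lift_snoc, RFun.fn_const, map_mul, map_pow,
        aeval_C, aeval_X, Fin.snoc_last, eq_ratCast, Rat.cast_one, one_pow, mul_one]
  have e3 : KZ.of (F.face 0 ⟨le_rfl, zero_le_one⟩).rep ∈ KZ.relations :=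
    RFun.rel_of_eqOn_zero fun x _ => by
      rw [RFun.fn_face, hF]
      simp [RFun.fn_mul]
  have : KZ.of G.rep - KZ.of ((RFun.const (1 / ((b : ℚ) + 1))).mul T).rep =
      (KZ.of F.dlast.rep - (KZ.of (F.face 1 ⟨zero_le_one, le_rfl⟩).rep -
          KZ.of (F.face 0 ⟨le_rfl, zero_le_one⟩).rep))
      - (KZ.of F.dlast.rep - KZ.of G.rep)
      + (KZ.of (F.face 1 ⟨zero_le_one, le_rfl⟩).rep -
          KZ.of ((RFun.const (1 / ((b : ℚ) + 1))).mul T).rep)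
      - KZ.of (F.face 0 ⟨le_rfl, zero_le_one⟩).rep := by abel
  rw [this]
  exact KZ.relations.sub_mem (KZ.relations.add_mem (KZ.relations.sub_mem hst e1) e2) e3

/-! ## One monomial, then every polynomial -/

/-- **One monomial**: `[□², c·x^a·y^b] ≡ [pt, c/((a+1)(b+1))]` — two Newton–Leibniz moves with
polynomial primitives, first in `y` (`[□², c x^a y^b] ≡ [□¹, c x^a/(b+1)]`), then in `x`
(`[□¹, c x^a/(b+1)] ≡ [pt, c/((a+1)(b+1))]`). [cite: KontsevichZagier2001, §1.2 rule (3)] -/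
theorem boxPolynomial_monomial (c : ℚ) (a b : ℕ) :
    KZ.of (RFun.poly (C c * X 0 ^ a * X 1 ^ b) : RFun 2).rep -
      KZ.of (RFun.const (c / (((a : ℚ) + 1) * ((b : ℚ) + 1))) : RFun 0).rep ∈ KZ.relations := by
  -- `Fin.last 1 = 1` in `Fin 2`
  have hl : (Fin.last 1 : Fin 2) = 1 := rfl
  -- the `y`-integration
  have h2 := boxPolynomial_rel_powMulLift (RFun.poly (C c * X 0 ^ a) : RFun 1) b
  have i2 : KZ.of (RFun.poly (C c * X 0 ^ a * X 1 ^ b) : RFun 2).rep -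
      KZ.of ((RFun.poly (X (Fin.last 1) ^ b)).mul
        (RFun.poly (C c * X 0 ^ a) : RFun 1).lift).rep ∈ KZ.relations :=
    RFun.rel_of_eqOn fun y _ => by
      simp only [RFun.fn_mul, RFun.fn_poly, RFun.fn_lift, Fin.init, map_mul, map_pow, aeval_C,
        aeval_X, Fin.castSucc_zero, hl]
      ring
  -- the `x`-integration
  have h1 := boxPolynomial_rel_powMulLift (RFun.const (c / ((b : ℚ) + 1)) : RFun 0) a
  have i1 : KZ.of ((RFun.const (1 / ((b : ℚ) + 1))).mul (RFun.poly (C c * X 0 ^ a) : RFun 1)).rep -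
      KZ.of ((RFun.poly (X (Fin.last 0) ^ a)).mul
        (RFun.const (c / ((b : ℚ) + 1)) : RFun 0).lift).rep ∈ KZ.relations :=
    RFun.rel_of_eqOn fun x _ => by
      simp only [RFun.fn_mul, RFun.fn_poly, RFun.fn_const, RFun.fn_lift, map_mul, map_pow, aeval_C,
        aeval_X, eq_ratCast, Fin.last_zero]
      push_cast
      ring
  -- the product of the two constants
  have i0 : KZ.of ((RFun.const (1 / ((a : ℚ) + 1))).mul
        (RFun.const (c / ((b : ℚ) + 1)) : RFun 0)).rep -
      KZ.of (RFun.const (c / (((a : ℚ) + 1) * ((b : ℚ) + 1))) : RFun 0).rep ∈ KZ.relations :=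
    RFun.rel_of_eqOn fun x _ => by
      simp only [RFun.fn_mul, RFun.fn_const]
      push_cast
      rw [div_mul_div_comm, one_mul]
  exact boxPolynomial_rel_trans i2 (boxPolynomial_rel_trans h2
    (boxPolynomial_rel_trans i1 (boxPolynomial_rel_trans h1 i0)))

/-- **Every polynomial**: `[□², P] ≡ [pt, γ]` for some `γ ∈ ℚ` — monomial by monomial
(`boxPolynomial_monomial`), the pieces merged by rule (1). [cite: KontsevichZagier2001, §1.2 rule (1)] -/
theorem boxPolynomial_exists_const (P : MvPolynomial (Fin 2) ℚ) :
    ∃ γ : ℚ, KZ.of (RFun.poly P : RFun 2).rep - KZ.of (RFun.const γ : RFun 0).rep ∈ KZ.relations := by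
  induction P using MvPolynomial.induction_on' with
  | monomial u c =>
    refine ⟨c / (((u 0 : ℚ) + 1) * ((u 1 : ℚ) + 1)), ?_⟩
    have hP : (monomial u c : MvPolynomial (Fin 2) ℚ) = C c * X 0 ^ (u 0) * X 1 ^ (u 1) := by
      rw [monomial_eq, Finsupp.prod_pow, Fin.prod_univ_two, mul_assoc]
    rw [hP]
    exact boxPolynomial_monomial c (u 0) (u 1)
  | add p q hp hq =>
    obtain ⟨γ, hγ⟩ := hp
    obtain ⟨γ', hγ'⟩ := hq
    refine ⟨γ + γ', ?_⟩
    have hA := boxPolynomial_rel_add3 (RFun.poly (p + q) : RFun 2) (RFun.poly p) (RFun.poly q)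
      fun x _ => by simp only [RFun.fn_poly, map_add]
    have hB := boxPolynomial_rel_add3 (RFun.const (γ + γ') : RFun 0) (RFun.const γ) (RFun.const γ')
      fun x _ => by simp only [RFun.fn_const, Rat.cast_add]
    have : KZ.of (RFun.poly (p + q) : RFun 2).rep - KZ.of (RFun.const (γ + γ') : RFun 0).rep =
        (KZ.of (RFun.poly (p + q) : RFun 2).rep - KZ.of (RFun.poly p : RFun 2).rep -
            KZ.of (RFun.poly q : RFun 2).rep)
        + (KZ.of (RFun.poly p : RFun 2).rep - KZ.of (RFun.const γ : RFun 0).rep)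
        + (KZ.of (RFun.poly q : RFun 2).rep - KZ.of (RFun.const γ' : RFun 0).rep)
        - (KZ.of (RFun.const (γ + γ') : RFun 0).rep - KZ.of (RFun.const γ : RFun 0).rep -
            KZ.of (RFun.const γ' : RFun 0).rep) := by
      abel
    rw [this]
    exact KZ.relations.sub_mem (KZ.relations.add_mem (KZ.relations.add_mem hA hγ) hγ') hB

/-! ## The registered stub -/

/-- **STUB `boxPolynomial`** (crux `ReductionRigidity`, line `Sketch`, Padé box island `w = 2`):
a polynomial integrand on the closed square is a rational constant modulo moves —
`[□², P] ≡ [pt, γ]` with `γ = ∫_{□²} P ∈ ℚ`, for every representation `r` of `P` on `KZ.cube 2`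
(two Newton–Leibniz moves with polynomial primitives per monomial, merged by rule (1)).
[cite: KontsevichZagier2001, §1.2 rule (3)] -/
theorem stub_boxPolynomial : ∀ (P : MvPolynomial (Fin 2) ℚ) (r : IntegralRep 2),
    r.domain = cube 2 → EqOn r.integrand (fun p => (aeval p P : ℝ)) (cube 2) →
    ∃ (γ : ℚ) (s₀ : IntegralRep 0), s₀.domain = cube 0 ∧
      EqOn s₀.integrand (fun _ => (γ : ℝ)) (cube 0) ∧ KZ.of r - KZ.of s₀ ∈ KZ.relations := by
  intro P r hr hri
  obtain ⟨γ, hγ⟩ := boxPolynomial_exists_const P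
  have h0 : KZ.of r - KZ.of (RFun.poly P : RFun 2).rep ∈ KZ.relations :=
    KZ.of_sub_of_mem_relations_of_eqOn (by rw [RFun.rep_domain, hr]) fun x hx => by
      rw [hr] at hx
      rw [RFun.rep_integrand, RFun.fn_poly]
      exact hri hx
  refine ⟨γ, (RFun.const γ : RFun 0).rep, rfl, fun x _ => ?_, boxPolynomial_rel_trans h0 hγ⟩
  rw [RFun.rep_integrand, RFun.fn_const]

end Summit.KontsevichZagierPeriods.HermiteRigidity.ReductionRigidity
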